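import Literature.NumberTheory.Rogawski1990.LocalTransferChartRealisationStable   -- ★ p840171∕p840239∕p840442 F0P2-p02 (g8): `exists_mem_mk_eq_of_classOrbitalIntegral_ne_zero`, the box package; through it ★ p08 (iv-a,b,c)
import HarnessLib

/-!
# Chart realisation of prescribed (stable) orbital integrals — POINTWISE-ADMISSIBLE variant (the box may contain points where the canonical family is not pinned)
# (Harish-Chandra 1970 Part I §3; Rogawski 1990 §4.3 (4.3.1), §4.9, §8.2 Prop. 8.2.1 (c))

Topic `NumberTheory/Rogawski1990`; namespace `Literature.NumberTheory.Rogawski1990` (+ one `_root_.Literature.NumberTheory.Automorphic…` dot-lemma).  THEOREMS ONLY (no definition, no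
instance, no notation, no named fact, no `sorry`).  Cell `pub/hodgecm-mathlib` (D-0151), crux H413 = stmt-HodgeConjecture-24833, floor-2 line «N6nsGerm», stub `stub_N6nsS2` (LEAD
F0P3a-plan (g9) WORD T8-78 «(α″) S2 JUNCTION»); seat F0P2-p02 (g8).  HONEST LABEL: HC_CM is proved only modulo the printed citations until rung 0 closes; generic layer only.

WHY.  ★ `IsCanonical.exists_isLocSmooth_classOrbitalIntegral_mk_eq_of_chart` (F0P3a-p08 (g12), (iv-a)) and ★ `…stableOrbitalIntegralRel_eq_of_chart` (F0P2-p02, §2 of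
`LocalTransferChartRealisationStable`) ask the admissibility predicate `P` (where the canonical family `m` is pinned) at EVERY point `τ b` of the torus box `B₁`.  At an `H`-regular but
`G`-singular base point (print's Prop. 8.2.1 (c): `ε_H = (A_{a,b}, a)`) the box necessarily contains the hypersurface of `G`-singular torus points, where `P = IsLocalGRegular` fails; but the
transfer identity is only asserted at `G`-regular points.  This file re-runs both theorems with `P` required ONLY AT THE EVALUATION POINT: the same chart function `f^H` (pull-back of
`vol⁻¹ • g`, cut off to `e(K × B₁)`) realises `g` at every `b ∈ B₁` with `P (τ b)`, and its stable orbital integrals still vanish at every `a` not `st`-related into `τ(B₁)`.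
* §1 `IsCanonical.exists_isLocSmooth_classOrbitalIntegral_mk_eq_of_chart_of_mem` — (iv-a) pointwise (proof = p08's, with the admissible set `V := τ(B₁ ∩ {P ∘ τ})`).
* §2 `IsCanonical.exists_isLocSmooth_stableOrbitalIntegralRel_eq_of_chart_of_mem` — the stable package pointwise (proof = §2 of `…RealisationStable`).

## References
* [HarishChandra1970] Harish-Chandra (notes by G. van Dijk), *Harmonic Analysis on Reductive p-adic Groups*, LNM 162 (1970): Part I §3.
* [Rogawski1990] J. Rogawski, *Automorphic Representations of Unitary Groups in Three Variables*, Ann. of Math. Stud. 123 (1990): §4.3 (4.3.1) p. 43; §4.9 pp. 54–55; §8.2 Prop. 8.2.1 (c) pp. 113–115.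
-/

set_option autoImplicit false

noncomputable section

open Set Filter Topology MeasureTheory Measure
open Literature.MeasureTheory.Group
open scoped Pointwise

namespace Literature.NumberTheory.Rogawski1990

open Literature.NumberTheory.Automorphic

section Pointwise

variable {G : Type*} [Group G] [TopologicalSpace G] [IsTopologicalGroup G] [LocallyCompactSpace G] [SecondCountableTopology G]
  [T2Space G] [MeasurableSpace G] [BorelSpace G]
  [∀ γ : G, MeasurableSpace (G ⧸ Subgroup.centralizer ({γ} : Set G))]
  [∀ γ : G, BorelSpace (G ⧸ Subgroup.centralizer ({γ} : Set G))]
  {A B : Type*} [TopologicalSpace A] [TopologicalSpace B]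

/-- **REALISATION, POINTWISE-ADMISSIBLE (iv-a′).**  As ★ `IsCanonical.exists_isLocSmooth_classOrbitalIntegral_mk_eq_of_chart`, but the admissibility predicate `P` of the
canonical family is required only at the evaluation point: with the centraliser clause `Z(τ b) = T` and (SAT) on the whole box, ONE `f^H ∈ C_c^∞(G)` vanishing off `e(K × B₁)`
satisfies `Φ([τ b], f^H; m) = g b` at every `b ∈ B₁` with `P (τ b)`.  Proof: p08's, with the admissible set `V := {τ b : b ∈ B₁, P (τ b)}` in ★
`IsCanonical.classOrbitalIntegral_mk_eq_measureReal_smul_of_forall_conj_eq`. [cite: HarishChandra1970, Part I §3] [cite: Rogawski1990, §4.3 (4.3.1) p. 43; §8.2 Prop. 8.2.1 (c) p. 113] -/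
theorem _root_.Literature.NumberTheory.Automorphic.OrbitalMeasureFamily.IsCanonical.exists_isLocSmooth_classOrbitalIntegral_mk_eq_of_chart_of_mem
    {P : G → Prop} (hP : ∀ g x : G, P g → P (x * g * x⁻¹)) {ν : Measure G} [IsHaarMeasure ν] [ν.IsMulRightInvariant]
    {m : OrbitalMeasureFamily G} (hm : m.IsCanonical P ν)
    (T : Subgroup G) (hTc : IsClosed (T : Set G)) [MeasurableSpace (G ⧸ T)] [BorelSpace (G ⧸ T)]
    (ρ : Measure ↥T) [IsHaarMeasure ρ] [ρ.IsInvInvariant] (hρ : ρ (compactCore ↥T) = 1)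
    (e : OpenPartialHomeomorph (A × B) G) (s : A → G) (hs : Continuous s) (τ : B → G)
    (he : ∀ p ∈ e.source, e p = s p.1 * τ p.2 * (s p.1)⁻¹) {K : Set A} (hKc : IsCompact K) (hKo : IsOpen K) {a₀ : A} (ha₀ : a₀ ∈ K)
    {B₁ : Set B} (hB₁c : IsCompact B₁) (hB₁o : IsOpen B₁) (hKB : K ×ˢ B₁ ⊆ e.source)
    (hZ : ∀ b ∈ B₁, Subgroup.centralizer ({τ b} : Set G) = T)
    (hsat : ∀ b ∈ B₁, ∀ x : G, x * τ b * x⁻¹ ∈ e '' (K ×ˢ B₁) → x ∈ s '' K * (T : Set G))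
    (g : B → ℂ) (hg : IsLocallyConstant g) :
    ∃ fH : G → ℂ, IsLocSmooth fH ∧ (∀ y ∉ e '' (K ×ˢ B₁), fH y = 0) ∧
      ∀ b ∈ B₁, P (τ b) → classOrbitalIntegral m fH (ConjClasses.mk (τ b)) = g b := by
  -- the slice volume `vol ∈ (0, ∞)`
  set vol : ℝ := (quotientMeasure T ρ hTc ν).real (QuotientGroup.mk '' (s '' K) : Set (G ⧸ T)) with hvol
  have hΩo : IsOpen (e '' (K ×ˢ B₁)) := e.isOpen_image_of_subset_source (hKo.prod hB₁o) hKB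
  have hSc : IsCompact (s '' K) := hKc.image hs
  have hSm : MeasurableSet (QuotientGroup.mk '' (s '' K) : Set (G ⧸ T)) := measurableSet_image_mk_of_isCompact T hTc hSc
  have hvol_pos : ∀ b ∈ B₁, 0 < vol := fun b hb => by
    have hx₀ : s a₀ * τ b * (s a₀)⁻¹ ∈ e '' (K ×ˢ B₁) :=
      ⟨(a₀, b), Set.mk_mem_prod ha₀ hb, he (a₀, b) (hKB (Set.mk_mem_prod ha₀ hb))⟩
    have hpos := quotientMeasure_image_mk_pos_of_sat T hTc ρ ν hΩo (hsat b hb) hx₀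
    have hfin : quotientMeasure T ρ hTc ν (QuotientGroup.mk '' (s '' K)) < ⊤ :=
      (hSc.image (QuotientGroup.continuous_mk (N := T))).measure_lt_top
    exact ENNReal.toReal_pos hpos.ne' hfin.ne
  -- the chart function for `vol⁻¹ • g`
  obtain ⟨F, hF, hF0, hFv⟩ := exists_isLocSmooth_eq_on_chart e s τ he hKc hKo hB₁c hB₁o hKB (fun b => (vol⁻¹ : ℂ) * g b)
    (hg.comp fun z => (vol⁻¹ : ℂ) * z)
  refine ⟨F, hF, hF0, fun b hb hPb => ?_⟩
  -- the admissible part of the box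
  rw [hm.classOrbitalIntegral_mk_eq_measureReal_smul_of_forall_conj_eq hP T hTc ρ hρ (s '' K) (e '' (K ×ˢ B₁))
    {t | ∃ b' ∈ B₁, P (τ b') ∧ τ b' = t}
    (fun t ⟨b', hb', hP', ht⟩ => ht ▸ ⟨hP', hZ b' hb'⟩) (fun t ⟨b', hb', _, ht⟩ x hx => hsat b' hb' x (ht ▸ hx)) hF0 ⟨b, hb, hPb, rfl⟩
    (c := (vol⁻¹ : ℂ) * g b) (fun s' ⟨a, ha, hs'⟩ => hs' ▸ hFv a ha b hb) hSm]
  rw [← hvol, Complex.real_smul, ← mul_assoc, ← Complex.ofReal_inv, ← Complex.ofReal_mul, mul_inv_cancel₀ (hvol_pos b hb).ne', Complex.ofReal_one, one_mul]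

/-- **THE STABLE PACKAGE, POINTWISE-ADMISSIBLE.**  As ★ `IsCanonical.exists_isLocSmooth_stableOrbitalIntegralRel_eq_of_chart` with `P` only at the evaluation point: for
every locally constant `g : B → ℂ` one `f^H ∈ C_c^∞(G)` with `Φ^st(τ b, f^H) = g b` at every `b ∈ B₁` with `P (τ b)`, and `Φ^st(a, f^H) = 0` at every `a` not `st`-related
into `τ(B₁)` (`st` containing conjugacy, symmetric, transitive, separating the box).  The `H`-regular ∕ `G`-singular base points of Prop. 8.2.1 (c) are served by this form.
[cite: Rogawski1990, §4.3 (4.3.1) p. 43; §4.9 p. 54; §8.2 Prop. 8.2.1 (c) p. 113] [cite: HarishChandra1970, Part I §3] -/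
theorem _root_.Literature.NumberTheory.Automorphic.OrbitalMeasureFamily.IsCanonical.exists_isLocSmooth_stableOrbitalIntegralRel_eq_of_chart_of_mem
    {P : G → Prop} (hP : ∀ g x : G, P g → P (x * g * x⁻¹)) {ν : Measure G} [IsHaarMeasure ν] [ν.IsMulRightInvariant]
    {m : OrbitalMeasureFamily G} (hm : m.IsCanonical P ν)
    (T : Subgroup G) (hTc : IsClosed (T : Set G)) [MeasurableSpace (G ⧸ T)] [BorelSpace (G ⧸ T)]
    (ρ : Measure ↥T) [IsHaarMeasure ρ] [ρ.IsInvInvariant] (hρ : ρ (compactCore ↥T) = 1)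
    (e : OpenPartialHomeomorph (A × B) G) (s : A → G) (hs : Continuous s) (τ : B → G)
    (he : ∀ p ∈ e.source, e p = s p.1 * τ p.2 * (s p.1)⁻¹) {K : Set A} (hKc : IsCompact K) (hKo : IsOpen K) {a₀ : A} (ha₀ : a₀ ∈ K)
    {B₁ : Set B} (hB₁c : IsCompact B₁) (hB₁o : IsOpen B₁) (hKB : K ×ˢ B₁ ⊆ e.source)
    (hZ : ∀ b ∈ B₁, Subgroup.centralizer ({τ b} : Set G) = T)
    (hsat : ∀ b ∈ B₁, ∀ x : G, x * τ b * x⁻¹ ∈ e '' (K ×ˢ B₁) → x ∈ s '' K * (T : Set G))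
    (st : G → G → Prop) (hconj : ∀ a x : G, st a (x * a * x⁻¹)) (hsymm : ∀ a a', st a a' → st a' a)
    (htrans : ∀ a a' a'', st a a' → st a' a'' → st a a'') (hsep : ∀ b ∈ B₁, ∀ b' ∈ B₁, st (τ b) (τ b') → b = b')
    (g : B → ℂ) (hg : IsLocallyConstant g) :
    ∃ fH : G → ℂ, IsLocSmooth fH ∧ (∀ b ∈ B₁, P (τ b) → stableOrbitalIntegralRel st m fH (τ b) = g b) ∧
      ∀ a : G, (∀ b ∈ B₁, ¬ st a (τ b)) → stableOrbitalIntegralRel st m fH a = 0 := by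
  obtain ⟨fH, hfH, hf0, hval⟩ := hm.exists_isLocSmooth_classOrbitalIntegral_mk_eq_of_chart_of_mem hP T hTc ρ hρ e s hs τ he hKc hKo ha₀ hB₁c hB₁o hKB
    hZ hsat g hg
  -- every class related to `a` with non-zero orbital integral is a box class `[τ b']` with `st a (τ b')`
  have key : ∀ (a : G) (c : ConjClasses G), st a (Quotient.out c) → classOrbitalIntegral m fH c ≠ 0 → ∃ b' ∈ B₁, c = ConjClasses.mk (τ b') ∧ st a (τ b') := by
    intro a c hac hc
    obtain ⟨b', hb', rfl⟩ := exists_mem_mk_eq_of_classOrbitalIntegral_ne_zero m e s τ he hKc hB₁c hKB hf0 hc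
    refine ⟨b', hb', rfl, ?_⟩
    obtain ⟨y, hy⟩ := isConj_iff.1 (ConjClasses.mk_eq_mk_iff_isConj.1 (Quotient.out_eq (ConjClasses.mk (τ b'))).symm)
    have hst : st (τ b') (Quotient.out (ConjClasses.mk (τ b'))) := by rw [← hy]; exact hconj _ _
    exact htrans _ _ _ hac (hsymm _ _ hst)
  refine ⟨fH, hfH, fun b hb hPb => ?_, fun a ha => ?_⟩
  · have hc₀ : st (τ b) (Quotient.out (ConjClasses.mk (τ b))) := by
      obtain ⟨y, hy⟩ := isConj_iff.1 (ConjClasses.mk_eq_mk_iff_isConj.1 (Quotient.out_eq (ConjClasses.mk (τ b))).symm)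
      rw [← hy]; exact hconj _ _
    rw [stableOrbitalIntegralRel_eq_classOrbitalIntegral_of_forall_ne st m fH (τ b) (ConjClasses.mk (τ b)) hc₀ fun c hc hne => ?_, hval b hb hPb]
    by_contra hO
    obtain ⟨b', hb', rfl, hst⟩ := key (τ b) c hc hO
    exact hne (by rw [hsep b hb b' hb' hst])
  · exact stableOrbitalIntegralRel_eq_zero_of_forall st m fH a fun c hc => by
      by_contra hO
      obtain ⟨b', hb', -, hst⟩ := key a c hc hO
      exact ha b' hb' hst

end Pointwise

end Literature.NumberTheory.Rogawski1990

end
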